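import Summits.AnomalousDissipation.AnomalousDissipation.Theorems.NeutralTaylorWavesNewtonRealisationStubBorderedFredholm
import Summits.AnomalousDissipation.AnomalousDissipation.Theorems.NeutralTaylorWavesNewtonRealisationStubQuadraticNewton
import Summits.AnomalousDissipation.AnomalousDissipation.Theorems.NeutralTaylorWavesNewtonRealisationStubDriftAbsorption
import Summits.AnomalousDissipation.AnomalousDissipation.Theorems.NeutralTaylorWavesNewtonRealisationStubAprioriTransfer
import Summits.AnomalousDissipation.AnomalousDissipation.Theorems.NeutralTaylorWavesNewtonRealisationStubLatticeDictionary
import Summits.AnomalousDissipation.AnomalousDissipation.Theorems.NeutralTaylorWavesNewtonRealisationStubEllipticDensity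

/-!
# Quantitative bordered persistence of drifted steady Navier–Stokes states on `T³` at fixed viscosity
# (core of line `Sketch` for crux `NewtonRealisation`, stmt-AnomalousDissipation-16315, route NeutralTaylorWaves)

`quantBorderedPersistence` (the transfer `C⁺` of the line): there are universal `k : ℕ`, `A > 0` such that an EXACT
smooth divergence-free mean-zero drifted steady state `(u₀, p₀, c)` of a smooth mean-zero force `f₀`,
`u₀·∇u₀ − νΔu₀ + ∇p₀ − c∂₃u₀ = f₀` (`0 < ν ≤ 1`), with `|c|, |u₀| ≤ C`, `|∇u₀| ≤ Cν⁻¹` and the bordered `L²`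
a-priori bound with constant `M`, persists to EVERY smooth divergence-free mean-zero force `f` with
`‖f − f₀‖²₂ ≤ P⁻⁴`, `P := A(1+M)^k(1+C)^kν^{-k}`, as an exact smooth drifted steady state `(u, p, c')` with
`‖u − u₀‖²₂ + ‖∇(u − u₀)‖²₂ + (c' − c)² ≤ P²‖f − f₀‖²₂` — the quantitative, bordered twin of the tree's
conserved-mean steady implicit-function theorem `SteadyLatticeDrift.steadyPersistsInLeaf_of_nondeg`
(Temam 1979 Ch. II §1 Thm. 1.3), run in the same Fourier-lattice frame: state space `W × ℝ` (drift = extra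
unknown, phase functional `ℓ h = Re⟪cf(D₃x₀), h⟫ = ∫⟪v, ∂₃u₀⟫` = extra equation), injectivity and the inverse
bound `2P₁` of the bordered linearisation from the landed `stub_aprioriTransfer` + `stub_ellipticDensity`,
Fredholm from `stub_borderedFredholm` (compactness of `B(x₀,·)+B(·,x₀)` and `D₃`), the zero from
`stub_quadraticNewton` (Lipschitz constant `2‖B‖ + 2‖D₃‖`, constants `A := A₁(16 Lip + 48)`), dictionary and
synthesis from `stub_latticeDictionary`, the `H¹` estimate from `SteadyLattice.h1_le_of_coeff`.

References: Temam 1979, Ch. II §1 (Thm. 1.3 and proof); Magnus 2022, Prop. 6.7; Chow–Hale 1982 §2.4 (bordering).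
-/

set_option linter.dupNamespace false

noncomputable section

open scoped BigOperators Topology ENNReal NNReal InnerProductSpace ComplexConjugate
open Filter Set Function MeasureTheory UnitAddTorus
open Literature.Analysis Literature.Analysis.FunctionSpaces Literature.Analysis.FunctionSpaces.Torus
open Literature.Analysis.FunctionSpaces.EuclideanSpace
open Literature.Analysis.FluidPDE.ScalarFourier
open Literature.Analysis.FluidPDE.SteadyLattice Literature.Analysis.FluidPDE.SteadyLatticeDrift

namespace Summit.AnomalousDissipation.AnomalousDissipation.Theorems.NewtonRealisation.Core

open Summit.AnomalousDissipation.AnomalousDissipation.Theorems.NewtonRealisation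


/-- The flat unit three-torus (local notation). -/
local notation "𝕋³" => UnitAddTorus (Fin 3)
/-- Velocity values (local notation). -/
local notation "E³" => EuclideanSpace ℝ (Fin 3)
/-- Square-summable families `ℤ³ → ℂ³` (local notation). -/
local notation "ℓ2" => lp (fun _ : Fin 3 → ℤ => EuclideanSpace ℂ (Fin 3)) 2
/-- The physical coefficients `x̌(k) = x(k)/|k|²` of a lattice family (local notation, = the frame's `cf`). -/
local notation:max "cf[" x "]" =>
  ((fun mm : Fin 3 → ℤ => (((freqNormSq mm)⁻¹ : ℝ) : ℂ)) • (x : (Fin 3 → ℤ) → EuclideanSpace ℂ (Fin 3)))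
/-- The coordinates of an element of `ℓ²` / of the state space (local notation). -/
local notation:max "cw[" x "]" => (((x : ℓ2)) : (Fin 3 → ℤ) → EuclideanSpace ℂ (Fin 3))
/-- The convective symbol `N(a, b)(k)` as a vector of `ℂ³` (local notation, = the frame's `nl`). -/
local notation:max "nl[" a "," b "]" k:max =>
  (WithLp.toLp 2 (fun pp : Fin 3 => transportSym (fun jj mm => (a : (Fin 3 → ℤ) → EuclideanSpace ℂ (Fin 3)) mm jj)
    (fun mm => (b : (Fin 3 → ℤ) → EuclideanSpace ℂ (Fin 3)) mm pp) k) : EuclideanSpace ℂ (Fin 3))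
/-- `k · v` for `k ∈ ℤ³`, `v ∈ ℂ³` (local notation, = the frame's `kdot`). -/
local notation:max "kdot[" k "," v "]" => (∑ jj : Fin 3, ((k jj : ℤ) : ℂ) * (v : EuclideanSpace ℂ (Fin 3)) jj)




set_option maxHeartbeats 3200000 in
/-- **Quantitative bordered persistence of drifted steady states under a change of force (fixed viscosity).**
There are universal `k : ℕ`, `A > 0` such that: if `(u₀, p₀, c)` is an exact smooth divergence-free mean-zero
drifted steady state of the smooth mean-zero force `f₀`, `u₀·∇u₀ − νΔu₀ + ∇p₀ − c∂₃u₀ = f₀` (`0 < ν ≤ 1`), with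
`|c|, |u₀| ≤ C`, `|∇u₀| ≤ Cν⁻¹` and the bordered `L²` a-priori bound with constant `M`, then every smooth
divergence-free mean-zero force `f` with `‖f − f₀‖²₂ ≤ P⁻⁴`, `P := A(1+M)^k(1+C)^kν^{-k}`, is realised by an exact
smooth drifted steady state `(u, p, c')` with `‖u − u₀‖²₂ + ‖∇(u − u₀)‖²₂ + (c' − c)² ≤ P²‖f − f₀‖²₂` (bordered
Newton–Kantorovich on `SteadyLattice.W × ℝ`; the quantitative twin of
`SteadyLatticeDrift.steadyPersistsInLeaf_of_nondeg`). [cite: Temam1979, Ch. II §1 Thm. 1.3; Magnus2022, Prop. 6.7] -/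
theorem quantBorderedPersistence :
    ∃ (k : ℕ) (A : ℝ), 0 < A ∧ ∀ (ν C M : ℝ) (f₀ f u₀ : 𝕋³ → E³) (p₀ : 𝕋³ → ℝ) (c : ℝ),
      0 < ν → ν ≤ 1 → 0 ≤ C → 0 ≤ M →
      IsSmooth f₀ → HasZeroMean f₀ → IsSmooth f → IsDivFree f → HasZeroMean f →
      IsSmooth u₀ → IsSmooth p₀ → IsDivFree u₀ → HasZeroMean u₀ → |c| ≤ C → (∀ x, ‖u₀ x‖ ≤ C) →
      (∀ (i : Fin 3) x, ‖Torus.partialDeriv i u₀ x‖ ≤ C * ν⁻¹) →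
      (∀ x, Torus.convect u₀ u₀ x - ν • Torus.laplacian u₀ x + Torus.gradient p₀ x -
          c • Torus.partialDeriv (2 : Fin 3) u₀ x = f₀ x) →
      (∀ (v : 𝕋³ → E³) (r : 𝕋³ → ℝ) (b : ℝ), IsSmooth v → IsSmooth r → IsDivFree v → HasZeroMean v →
      MeasureTheory.integral MeasureTheory.volume (fun x => ‖v x‖ ^ 2) + b ^ 2 ≤
        M ^ 2 * (MeasureTheory.integral MeasureTheory.volume (fun x =>
          ‖Torus.convect u₀ v x + Torus.convect v u₀ x - ν • Torus.laplacian v x + Torus.gradient r x -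
            c • Torus.partialDeriv (2 : Fin 3) v x - b • Torus.partialDeriv (2 : Fin 3) u₀ x‖ ^ 2) +
          (MeasureTheory.integral MeasureTheory.volume (fun x =>
            inner ℝ (v x) (Torus.partialDeriv (2 : Fin 3) u₀ x))) ^ 2)) →
      MeasureTheory.integral MeasureTheory.volume (fun x => ‖f x - f₀ x‖ ^ 2) ≤
        ((A * (1 + M) ^ k * (1 + C) ^ k * ν⁻¹ ^ k) ^ 4)⁻¹ →
      ∃ (u : 𝕋³ → E³) (p : 𝕋³ → ℝ) (c' : ℝ), IsSmooth u ∧ IsSmooth p ∧ IsDivFree u ∧ HasZeroMean u ∧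
        (∀ x, Torus.convect u u x - ν • Torus.laplacian u x + Torus.gradient p x -
            c' • Torus.partialDeriv (2 : Fin 3) u x = f x) ∧
        MeasureTheory.integral MeasureTheory.volume (fun x => ‖u x - u₀ x‖ ^ 2) +
            gradNormSq (fun x => u x - u₀ x) + (c' - c) ^ 2 ≤
          (A * (1 + M) ^ k * (1 + C) ^ k * ν⁻¹ ^ k) ^ 2 *
            MeasureTheory.integral MeasureTheory.volume (fun x => ‖f x - f₀ x‖ ^ 2) := by
  have hL1 := @LatticeDictionary.stub_latticeDictionary
  have hL2 := @AprioriTransfer.stub_aprioriTransfer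
  have hL3 := EllipticDensity.stub_ellipticDensity
  have hDA := DriftAbsorption.stub_driftAbsorption
  have hFred := @BorderedFredholm.stub_borderedFredholm
  have hNewt := @QuadraticNewton.stub_quadraticNewton
  -- §0 universal objects: the state space, the bilinear map and its bound, the drift direction `e₃`
  obtain ⟨W, hW, hWc⟩ := exists_space
  haveI : CompleteSpace W := completeSpace_W hWc
  obtain ⟨B, hB, hBb⟩ := exists_bilinear hW
  obtain ⟨CB, hCB, hBbound⟩ := hBb.bound
  have hBbound' : ∀ x y : W, ‖B x y‖ ≤ CB * ‖x‖ * ‖y‖ := fun x y => hBbound x y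
  set M₃ : EuclideanSpace ℂ (Fin 3) := complexify (EuclideanSpace.single (2 : Fin 3) (1 : ℝ)) with hM₃
  have hM₃c : conjVec M₃ = M₃ := by
    rw [hM₃]; exact conjVec_complexify _
  obtain ⟨D₃, hD₃', hD₃c⟩ := exists_drift hW hWc hM₃c
  have hkM : ∀ k : Fin 3 → ℤ, kdot[k, M₃] = ((k (2 : Fin 3) : ℤ) : ℂ) := by
    intro k
    simp [hM₃, Fin.sum_univ_three, complexify_apply]
  have hD₃ : ∀ x : W, cw[D₃ x] = fun k => (2 * Real.pi * Complex.I * ((k (2 : Fin 3) : ℤ) : ℂ)) • cf[cw[x]] k := by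
    intro x; rw [hD₃']; funext k; rw [hkM k]
  -- the universal constants
  obtain ⟨k₁, A₁, hA₁, hL3⟩ := hL3
  set Lip : ℝ := 2 * CB + 2 * ‖D₃‖ with hLip
  have hLip0 : 0 ≤ Lip := by positivity
  refine ⟨k₁, A₁ * (16 * Lip + 48), by positivity, ?_⟩
  intro ν C M f₀ f u₀ p₀ c hν hν1 hC hM hf₀ hf₀m hf hfd hfm hu₀ hp₀ hu₀d hu₀m hcC hsup₀ hsup₁ heq hBB hsmall
  have hν0 : ν ≠ 0 := hν.ne'
  set P₁ : ℝ := A₁ * (1 + M) ^ k₁ * (1 + C) ^ k₁ * ν⁻¹ ^ k₁ with hP₁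
  have hP₁pos : 0 < P₁ := by positivity
  have hPhyp : A₁ * (16 * Lip + 48) * (1 + M) ^ k₁ * (1 + C) ^ k₁ * ν⁻¹ ^ k₁ = (16 * Lip + 48) * P₁ := by
    rw [hP₁]; ring
  rw [hPhyp] at hsmall ⊢
  set I : ℝ := MeasureTheory.integral MeasureTheory.volume (fun x => ‖f x - f₀ x‖ ^ 2) with hI
  have hI0 : 0 ≤ I := MeasureTheory.integral_nonneg fun _ => sq_nonneg _
  -- §1 the dictionary: base point, forces
  obtain ⟨hD1, hD2, hD3f⟩ := hL1 hW hB hD₃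
  have hst₀ : FluidPDE.Torus.IsSteadyNSState ν f₀
      (fun x => u₀ x - c • EuclideanSpace.single (2 : Fin 3) (1 : ℝ)) p₀ :=
    (hDA ν f₀ u₀ p₀ c hu₀ hp₀ hu₀d hu₀m heq).1
  obtain ⟨x₀, hx₀, hGx₀⟩ := hD1 ν f₀ u₀ p₀ c hν hf₀ hf₀m hu₀ hu₀d hu₀m hst₀
  obtain ⟨Fw, F₀w, hFw, hF₀w, hFdist⟩ := hD3f f f₀ hf hfm hf₀ hf₀m
  have hx₀r : RapidDecay cf[cw[x₀]] := by
    rw [hx₀]; exact hu₀.complexify_comp.rapidDecay_mFourierCoeff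
  set a : ℝ := 4 * Real.pi ^ 2 * ν with ha
  have ha0 : a ≠ 0 := by positivity
  have hbase : a • x₀ - c • D₃ x₀ + B x₀ x₀ = F₀w := by
    refine Subtype.ext (lp.ext (funext fun k => ?_))
    have h1 := hGx₀ k
    have h2 := hF₀w k
    rw [← h2] at h1
    exact h1
  -- §2 the border functional `ℓ h = Re Σ ⟪ȟ(k), (∂₃u₀)^(k)⟫`
  have hmem : Memℓp (cf[cw[D₃ x₀]]) 2 := by
    refine memℓp_two_of_tsum_ne_top (ne_top_of_le_ne_top (l2_tsum_enorm_sq_ne_top ((D₃ x₀ : W) : ℓ2)) ?_)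
    exact ENNReal.tsum_le_tsum fun k => by
      refine pow_le_pow_left' ?_ 2
      rw [← ofReal_norm, ← ofReal_norm]
      exact ENNReal.ofReal_le_ofReal (norm_cf_le _ k)
  set y₁ : ℓ2 := ⟨cf[cw[D₃ x₀]], hmem⟩ with hy₁
  have hy₁c : cw[y₁] = cf[cw[D₃ x₀]] := rfl
  set ℓl : W →ₗ[ℝ] ℝ :=
    { toFun := fun h => (inner ℂ y₁ ((h : W) : ℓ2)).re
      map_add' := fun h h' => by
        simp only [Submodule.coe_add, inner_add_right, Complex.add_re]
      map_smul' := fun r h => by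
        simp only [Submodule.coe_smul, RingHom.id_apply, smul_eq_mul]
        rw [RCLike.real_smul_eq_coe_smul (K := ℂ) r, inner_smul_right]
        exact Complex.re_ofReal_mul r _ } with hℓl
  have hℓlb : ∀ h : W, ‖ℓl h‖ ≤ ‖y₁‖ * ‖h‖ := by
    intro h
    change ‖(inner ℂ y₁ ((h : W) : ℓ2)).re‖ ≤ ‖y₁‖ * ‖h‖
    refine (Complex.abs_re_le_norm _).trans ?_
    rw [← norm_coeW]
    exact norm_inner_le_norm _ _
  set ℓ : W →L[ℝ] ℝ := ℓl.mkContinuous ‖y₁‖ hℓlb with hℓdef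
  have hℓapply : ∀ h : W, ℓ h = (inner ℂ y₁ ((h : W) : ℓ2)).re := fun h => rfl
  have hℓ : ∀ h : W, ℓ h = ∑' k : Fin 3 → ℤ, (inner ℂ (cf[cw[h]] k) (cw[D₃ x₀] k)).re := by
    intro h
    rw [hℓapply, lp.inner_eq_tsum, Complex.re_tsum (lp.summable_inner _ _)]
    refine tsum_congr fun k => ?_
    change (inner ℂ (cw[y₁] k) (cw[h] k)).re = (inner ℂ (cf[cw[h]] k) (cw[D₃ x₀] k)).re
    rw [hy₁c, cf_apply, cf_apply, inner_smul_left, inner_smul_left, Complex.conj_ofReal,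
      ← inner_conj_symm (cw[h] k) (cw[D₃ x₀] k), Complex.re_ofReal_mul, Complex.re_ofReal_mul, Complex.conj_re]
  -- §3 the bordered linearisation: compact perturbation of `a·1`, injective with a quantitative bound
  set K : W →L[ℝ] W := (hBb.deriv (x₀, x₀)).comp ((ContinuousLinearMap.id ℝ W).prod (ContinuousLinearMap.id ℝ W))
    with hK
  have hKw : ∀ w, K w = B x₀ w + B w x₀ := fun w => by simp [hK, IsBoundedBilinearMap.deriv_apply]
  have hKc : IsCompactOperator K := isCompactOperator_linearised hWc hB x₀ hx₀r K hKw
  set K' : W →L[ℝ] W := K - c • D₃ with hK'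
  have hK'w : ∀ w, K' w = B x₀ w + B w x₀ - c • D₃ w := fun w => by
    simp [hK', hKw]
  have hK'c : IsCompactOperator K' := by
    have h := hKc.sub (hD₃c.smul c)
    have e : ((K' : W →L[ℝ] W) : W → W) = (K : W → W) - (c • (D₃ : W → W)) := by
      funext w; simp [hK']
    rwa [e]
  have hapr := hL2 hW hB hD₃ ν c M u₀ x₀ ℓ hν hu₀ hu₀d hu₀m hx₀ hℓ hBB
  have hell := hL3 hW hB hBb hD₃ ν c M C u₀ x₀ ℓ hν hν1 hM hC hu₀ hu₀d hu₀m hcC hsup₀ hsup₁ hx₀ hapr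
  rw [← hP₁] at hell
  have hform : ∀ (h : W) (t : ℝ), a • h - c • D₃ h + B x₀ h + B h x₀ - t • D₃ x₀ = a • h + K' h - t • D₃ x₀ := by
    intro h t; rw [hK'w]; abel
  have hinj : ∀ (x : W) (t : ℝ), a • x + K' x - t • D₃ x₀ = 0 → ℓ x = 0 → x = 0 ∧ t = 0 := by
    intro x t h1 h2
    have h := hell x t
    rw [hform, h1, h2, norm_zero, abs_zero, add_zero, mul_zero] at h
    constructor
    · exact norm_eq_zero.1 (le_antisymm (by linarith [abs_nonneg t]) (norm_nonneg _))
    · exact abs_eq_zero.1 (le_antisymm (by linarith [norm_nonneg x]) (abs_nonneg _))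
  obtain ⟨Aeq, hAeq⟩ := hFred K' hK'c a ha0 (D₃ x₀) ℓ hinj
  have hAform : ∀ (h : W) (η : ℝ), Aeq (h, η) = (a • h - c • D₃ h - η • D₃ x₀ + B x₀ h + B h x₀, ℓ h) := by
    intro h η
    rw [hAeq, hK'w]
    ext1
    · change a • h + (B x₀ h + B h x₀ - c • D₃ h) - η • D₃ x₀ = a • h - c • D₃ h - η • D₃ x₀ + B x₀ h + B h x₀
      abel
    · rfl
  -- the inverse bound `‖A⁻¹‖ ≤ 2 P₁`
  have hinv : ‖(Aeq.symm : (W × ℝ) →L[ℝ] (W × ℝ))‖ ≤ 2 * P₁ := by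
    refine ContinuousLinearMap.opNorm_le_bound _ (by positivity) fun y => ?_
    have hy : Aeq (Aeq.symm y) = y := Aeq.apply_symm_apply y
    set h : W := (Aeq.symm y).1 with hh
    set η : ℝ := (Aeq.symm y).2 with hη
    have hpair : Aeq.symm y = (h, η) := rfl
    rw [hpair, hAform] at hy
    have h1 : a • h - c • D₃ h - η • D₃ x₀ + B x₀ h + B h x₀ = y.1 := congrArg Prod.fst hy
    have h2 : ℓ h = y.2 := congrArg Prod.snd hy
    have hb := hell h η
    rw [show a • h - c • D₃ h + B x₀ h + B h x₀ - η • D₃ x₀ = y.1 by rw [← h1]; abel, h2] at hb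
    have hfst : ‖y.1‖ ≤ ‖y‖ := norm_fst_le y
    have hsnd : |y.2| ≤ ‖y‖ := by rw [← Real.norm_eq_abs]; exact norm_snd_le y
    calc ‖(Aeq.symm : (W × ℝ) →L[ℝ] (W × ℝ)) y‖ = ‖((h, η) : W × ℝ)‖ := by
          rw [ContinuousLinearEquiv.coe_coe, hpair]
      _ = max ‖h‖ ‖η‖ := rfl
      _ ≤ ‖h‖ + |η| := max_le (le_add_of_nonneg_right (abs_nonneg _))
          (by rw [Real.norm_eq_abs]; linarith [norm_nonneg h])
      _ ≤ P₁ * (‖y.1‖ + |y.2|) := hb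
      _ ≤ P₁ * (‖y‖ + ‖y‖) := by gcongr
      _ = 2 * P₁ * ‖y‖ := by ring
  -- §4 the Newton step
  have hρ : ‖a • x₀ - c • D₃ x₀ + B x₀ x₀ - Fw‖ ≤ Real.sqrt I := by
    rw [hbase, norm_sub_rev]
    calc ‖Fw - F₀w‖ = Real.sqrt (‖Fw - F₀w‖ ^ 2) := (Real.sqrt_sq (norm_nonneg _)).symm
      _ ≤ Real.sqrt I := Real.sqrt_le_sqrt hFdist
  have hρ0 : 0 ≤ ‖a • x₀ - c • D₃ x₀ + B x₀ x₀ - Fw‖ := norm_nonneg _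
  have hPbig : 0 < (16 * Lip + 48) * P₁ := by positivity
  have hsqrtI : Real.sqrt I ≤ (((16 * Lip + 48) * P₁) ^ 2)⁻¹ := by
    have h1 : Real.sqrt I ≤ Real.sqrt ((((16 * Lip + 48) * P₁) ^ 4)⁻¹) := Real.sqrt_le_sqrt hsmall
    have h2 : Real.sqrt ((((16 * Lip + 48) * P₁) ^ 4)⁻¹) = (((16 * Lip + 48) * P₁) ^ 2)⁻¹ := by
      rw [Real.sqrt_inv, show ((16 * Lip + 48) * P₁) ^ 4 = ((((16 * Lip + 48) * P₁) ^ 2)) ^ 2 by ring,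
        Real.sqrt_sq (by positivity)]
    rw [h2] at h1
    exact h1
  have hprem : 4 * (2 * CB + 2 * ‖D₃‖) * (2 * P₁) * ((2 * P₁) * ‖a • x₀ - c • D₃ x₀ + B x₀ x₀ - Fw‖) ≤ 1 := by
    rw [← hLip]
    have hρ' : ‖a • x₀ - c • D₃ x₀ + B x₀ x₀ - Fw‖ ≤ (((16 * Lip + 48) * P₁) ^ 2)⁻¹ := hρ.trans hsqrtI
    calc 4 * Lip * (2 * P₁) * ((2 * P₁) * ‖a • x₀ - c • D₃ x₀ + B x₀ x₀ - Fw‖)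
        = (16 * Lip * P₁ ^ 2) * ‖a • x₀ - c • D₃ x₀ + B x₀ x₀ - Fw‖ := by ring
      _ ≤ (16 * Lip * P₁ ^ 2) * (((16 * Lip + 48) * P₁) ^ 2)⁻¹ :=
          mul_le_mul_of_nonneg_left hρ' (by positivity)
      _ = (16 * Lip) / (16 * Lip + 48) ^ 2 := by
          field_simp
      _ ≤ 1 := by
          rw [div_le_one (by positivity)]
          nlinarith
  obtain ⟨x, β, hzero, -, hxclose, hβclose⟩ :=
    hNewt B CB hBb hCB.le hBbound' D₃ ℓ a Fw x₀ c (2 * P₁) Aeq hAform hinv hprem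
  -- §5 synthesis of the classical drifted steady state
  have hxeq : ∀ k : Fin 3 → ℤ, cw[((4 * Real.pi ^ 2 * ν) • x - β • D₃ x + B x x : W)] k =
      FluidPDE.Torus.lerayCoeff k (mFourierCoeff (complexify ∘ f) k) := by
    intro k; rw [← ha, hzero, hFw k]
  obtain ⟨u, p, hu, hp, hud, hum, hueq, hû⟩ := hD2 ν f x β hν hf hfd hfm hxeq
  refine ⟨u, p, β, hu, hp, hud, hum, hueq, ?_⟩
  -- §6 the `H¹` estimate
  have hcoef : mFourierCoeff (complexify ∘ fun y => u y - u₀ y) = cf[cw[((x - x₀ : W))]] := by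
    have e : (complexify ∘ fun y => u y - u₀ y : 𝕋³ → EuclideanSpace ℂ (Fin 3)) =
        (complexify ∘ u) - (complexify ∘ u₀) := by
      funext y; simp
    rw [e, coeW_sub]
    funext k
    rw [mFourierCoeff_sub hu.complexify_comp.integrable hu₀.complexify_comp.integrable, hû, ← hx₀]
    simp only [Pi.smul_apply', Pi.sub_apply, smul_sub]
  have hv : IsSmooth (fun y => u y - u₀ y) := hu.sub hu₀
  have hH := h1_le_of_coeff hv ((x - x₀ : W) : ℓ2) hcoef
  rw [norm_coeW] at hH
  set ρ : ℝ := ‖a • x₀ - c • D₃ x₀ + B x₀ x₀ - Fw‖ with hρdef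
  have hρI : ρ ^ 2 ≤ I := by
    calc ρ ^ 2 ≤ (Real.sqrt I) ^ 2 := pow_le_pow_left₀ hρ0 hρ 2
      _ = I := Real.sq_sqrt hI0
  have hx1 : ‖x - x₀‖ ^ 2 ≤ (4 * P₁ * ρ) ^ 2 := by
    refine pow_le_pow_left₀ (norm_nonneg _) ?_ 2
    calc ‖x - x₀‖ ≤ 2 * (2 * P₁) * ρ := hxclose
      _ = 4 * P₁ * ρ := by ring
  have hβ1 : (β - c) ^ 2 ≤ (4 * P₁ * ρ) ^ 2 := by
    rw [← sq_abs]
    refine pow_le_pow_left₀ (abs_nonneg _) ?_ 2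
    calc |β - c| ≤ 2 * (2 * P₁) * ρ := hβclose
      _ = 4 * P₁ * ρ := by ring
  have hpi : Real.pi ^ 2 ≤ 16 := by nlinarith [Real.pi_lt_four, Real.pi_pos]
  have hLipP : (2 + 4 * Real.pi ^ 2) * 16 ≤ (16 * Lip + 48) ^ 2 := by nlinarith
  calc MeasureTheory.integral MeasureTheory.volume (fun y => ‖u y - u₀ y‖ ^ 2) +
        gradNormSq (fun y => u y - u₀ y) + (β - c) ^ 2
      ≤ (1 + 4 * Real.pi ^ 2) * ‖x - x₀‖ ^ 2 + (β - c) ^ 2 := by linarith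
    _ ≤ (1 + 4 * Real.pi ^ 2) * (4 * P₁ * ρ) ^ 2 + (4 * P₁ * ρ) ^ 2 := by gcongr
    _ = ((2 + 4 * Real.pi ^ 2) * 16) * P₁ ^ 2 * ρ ^ 2 := by ring
    _ ≤ (16 * Lip + 48) ^ 2 * P₁ ^ 2 * I := by gcongr
    _ = ((16 * Lip + 48) * P₁) ^ 2 * I := by ring

end Summit.AnomalousDissipation.AnomalousDissipation.Theorems.NewtonRealisation.Core

end
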